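import Literature.MathematicalPhysics.QuantumLattice.HeisenbergOrder
import Literature.MathematicalPhysics.QuantumLattice.LatticeToriLROProofs
import HarnessLib

/-!
# Néel order along even tori: two-point versus one-point form (discharge)

Sibling proof file of `Literature/MathematicalPhysics/QuantumLattice/HeisenbergOrder.lean`
(topic `MathematicalPhysics/QuantumLattice`; next to `HeisenbergOrderProofs.lean`, which
discharges the magnetisation bound). It **discharges the named fact**
`hasStaggeredEvenTorusLRO_iff_onePoint` of that file; no statement is introduced or changed.

* `hasStaggeredEvenTorusLRO_iff_onePoint_holds : hasStaggeredEvenTorusLRO_iff_onePoint` — for a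
  translation-invariant torus family `G L (x + v) (y + v) = G L x y`, staggered long-range order
  along the even tori `(ℤ/2kℤ)^d` in the two-point form
  `0 < liminf |Λ|⁻² Σ_{x,y} (-1)^x (-1)^y G_L(x,y)` (`HasStaggeredEvenTorusLRO`) is equivalent to
  the one-point form of the texts, `0 < liminf |Λ|⁻¹ Σ_x (-1)^x G_L(0,x)` (`|Λ| = L^d`,
  `L = 2(k+1)`).

Architecture of the (elementary) proof, for one even side `L`:
1. the pulled-back staggered double sum over the fundamental domain `halfOpenBox d L`, normalised
   by `|halfOpenBox d L|²`, is the staggered double sum over the torus with signs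
   `(-1)^{Σᵢ val xᵢ}` on canonical representatives, normalised by `L^{2d}`
   (`staggeredSum_torusPullback_succ` of `LatticeToriLROProofs`);
2. on an **even** torus the sign `x ↦ (-1)^{Σᵢ val xᵢ}` is a character of `(ℤ/Lℤ)^d`
   (`neg_one_pow_sum_val_add_of_even`; evenness of `L` is exactly what makes `val (a + b)` and
   `val a + val b` have the same parity), so `(-1)^x (-1)^{x+z} = (-1)^z`;
3. translation invariance `G(x, x + z) = G(0, z)` makes the inner sum independent of `x`
   (`staggeredSum_inner_eq_onePoint`), whence `Σ_{x,y} (-1)^x (-1)^y G(x,y) = L^d Σ_z (-1)^z G(0,z)`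
   and `L^{-2d} · L^d = L^{-d}` (`staggeredSum_div_eq_onePoint_div`);
4. the index shift `k ↦ k + 1` (sides `2(k+1) = 2k+2`) does not change a `liminf` along `atTop`
   (`Filter.liminf_nat_add`).

This is the finite-volume bookkeeping behind Dyson–Lieb–Simon's passage from (4) to (4′):
`|Λ|⁻¹ g_p = |Λ|⁻² Σ_{α,β} e^{-ip·(α-β)} ⟨S_α · S_β⟩ = |Λ|⁻¹ Σ_α e^{-ip·α} ⟨S_0 · S_α⟩` by
translation invariance of the periodic state, taken at the antiferromagnetic momentum
`p = (π, …, π)`, where `e^{-ip·α} = (-1)^{|α|}` is single-valued on the torus precisely when the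
sides are even.

## References
* [DysonLiebSimon1978] F. J. Dyson, E. H. Lieb, B. Simon, *Phase transitions in quantum spin
  systems with isotropic and nonisotropic interactions*, J. Stat. Phys. 18 (1978) 335–383: §1,
  eqs. (4), (4′), (5), (8), pp. 337–338 (periodic b.c., `Λ` "viewed as a torus"; the
  antiferromagnet via `p ↦ (π, …, π) - p`), §6, p. 365 (staggered sign `(-1)^{|α|}`,
  `|α| = Σ αᵢ`), Theorem 5.1 (`Lᵢ` even). Read in the reprint: E. H. Lieb, *Statistical
  Mechanics (Selecta)*, Springer, pp. 148–151, 167, 170.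
* T. Kennedy, E. H. Lieb, B. S. Shastry, J. Stat. Phys. 53 (1988) 1019, eq. (3) (the one-point
  form of Néel order).
-/

noncomputable section

open Filter Finset

namespace Literature.MathematicalPhysics.QuantumLattice

open Literature.Probability.LatticeModels

variable {d : ℕ}

/-! ### The Néel sign is a character on even tori -/

/-- On `ℤ/Lℤ` with `L` **even**, `a ↦ (-1)^{val a}` is multiplicative:
`(-1)^{val (a + b)} = (-1)^{val a} (-1)^{val b}`, because `val (a + b) ≡ val a + val b (mod L)` and
`L` is even. (For odd `L` this fails, e.g. `L = 3`, `a = b = 2`.)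
(Dyson–Lieb–Simon 1978, §1, p. 338 and §6, p. 365: the sign `(-1)^{|α|}` on boxes of even side.)
[folklore] -/
theorem neg_one_pow_val_add_of_even {L : ℕ} [NeZero L] (hL : Even L) (a b : ZMod L) :
    (-1 : ℝ) ^ (a + b).val = (-1) ^ a.val * (-1) ^ b.val := by
  rw [← pow_add, ZMod.val_add]
  conv_rhs => rw [← Nat.mod_add_div (a.val + b.val) L, pow_add, pow_mul, hL.neg_one_pow,
    one_pow, mul_one]

/-- On the even torus `(ℤ/Lℤ)^d` the Néel sign `x ↦ (-1)^{Σᵢ val xᵢ}` is a character: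
`(-1)^{Σ val (x+y)ᵢ} = (-1)^{Σ val xᵢ} (-1)^{Σ val yᵢ}`.
(Dyson–Lieb–Simon 1978, §6, p. 365, sign `(-1)^{|α|}`, `|α| = Σ αᵢ`, even sides.) [folklore] -/
theorem neg_one_pow_sum_val_add_of_even {L : ℕ} [NeZero L] (hL : Even L)
    (x y : TorusSite d L) :
    (-1 : ℝ) ^ (∑ i, ((x + y) i).val) = (-1) ^ (∑ i, (x i).val) * (-1) ^ (∑ i, (y i).val) := by
  rw [← Finset.prod_pow_eq_pow_sum, ← Finset.prod_pow_eq_pow_sum, ← Finset.prod_pow_eq_pow_sum,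
    ← Finset.prod_mul_distrib]
  exact Finset.prod_congr rfl fun i _ => by rw [Pi.add_apply, neg_one_pow_val_add_of_even hL]

/-- The Néel sign squares to one: `(-1)^{Σ val xᵢ} (-1)^{Σ val xᵢ} = 1`. [folklore] -/
theorem neg_one_pow_sum_val_mul_self {L : ℕ} (x : TorusSite d L) :
    (-1 : ℝ) ^ (∑ i, (x i).val) * (-1) ^ (∑ i, (x i).val) = 1 := by
  rw [← pow_add, ← two_mul, pow_mul, neg_one_sq, one_pow]

/-! ### Translation invariance: the inner sum does not depend on the base point -/

/-- For a translation-invariant two-point function `G (x + v) (y + v) = G x y` on an even torus,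
the staggered inner sum does not depend on the base point:
`Σ_y (-1)^x (-1)^y G(x, y) = Σ_z (-1)^z G(0, z)` (substitute `y = x + z`, use that the sign is a
character and squares to one). (Dyson–Lieb–Simon 1978, §1, eqs. (5), (8), p. 338: `|Λ|⁻¹ g_p`
as a one-point sum by translation invariance of the periodic state.) [folklore] -/
theorem staggeredSum_inner_eq_onePoint {L : ℕ} [NeZero L] (hL : Even L)
    (G : TorusSite d L → TorusSite d L → ℝ) (hG : ∀ v x y, G (x + v) (y + v) = G x y)
    (x : TorusSite d L) :
    ∑ y, (-1 : ℝ) ^ (∑ i, (x i).val) * (-1) ^ (∑ i, (y i).val) * G x y =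
      ∑ z, (-1 : ℝ) ^ (∑ i, (z i).val) * G 0 z := by
  rw [← Equiv.sum_comp (Equiv.addLeft x)
    (fun y => (-1 : ℝ) ^ (∑ i, (x i).val) * (-1) ^ (∑ i, (y i).val) * G x y)]
  refine Finset.sum_congr rfl fun z _ => ?_
  have hxz : G x (x + z) = G 0 z := by
    have h := hG x 0 z
    rwa [zero_add, add_comm z x] at h
  simp only [Equiv.coe_addLeft]
  rw [neg_one_pow_sum_val_add_of_even hL, hxz, ← mul_assoc, neg_one_pow_sum_val_mul_self,
    one_mul]

/-- Two-point versus one-point staggered sums on one even torus `(ℤ/Lℤ)^d`, `L ≠ 0` even, for a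
translation-invariant `G`:
`L^{-2d} Σ_{x,y} (-1)^x (-1)^y G(x,y) = L^{-d} Σ_z (-1)^z G(0,z)` (the double sum is `L^d` copies
of the one-point sum, `|(ℤ/Lℤ)^d| = L^d`). (Dyson–Lieb–Simon 1978, §1, (4) ⇔ (4′) via (5), (8),
pp. 337–338.) [folklore] -/
theorem staggeredSum_div_eq_onePoint_div {L : ℕ} [NeZero L] (hL : Even L)
    (G : TorusSite d L → TorusSite d L → ℝ) (hG : ∀ v x y, G (x + v) (y + v) = G x y) :
    (∑ x, ∑ y, (-1 : ℝ) ^ (∑ i, (x i).val) * (-1) ^ (∑ i, (y i).val) * G x y) /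
        (L : ℝ) ^ (2 * d) =
      (∑ z, (-1 : ℝ) ^ (∑ i, (z i).val) * G 0 z) / (L : ℝ) ^ d := by
  have hcard : (Fintype.card (TorusSite d L) : ℝ) = (L : ℝ) ^ d := by
    rw [Fintype.card_pi, prod_const, ZMod.card, card_univ, Fintype.card_fin, Nat.cast_pow]
  have hLd : (L : ℝ) ^ d ≠ 0 := pow_ne_zero d (Nat.cast_ne_zero.mpr (NeZero.ne L))
  rw [Finset.sum_congr rfl fun x _ => staggeredSum_inner_eq_onePoint hL G hG x, Finset.sum_const,
    Finset.card_univ, nsmul_eq_mul, hcard, two_mul, pow_add, mul_div_mul_left _ _ hLd]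

/-! ### Discharge -/

/-- **Discharge of `hasStaggeredEvenTorusLRO_iff_onePoint`** (two-point versus one-point form of
Néel order). For a translation-invariant torus family `G L (x + v) (y + v) = G L x y`,
`HasStaggeredEvenTorusLRO G`, i.e. `0 < liminf_k |Λ|⁻² Σ_{x,y ∈ (ℤ/2kℤ)^d} (-1)^x (-1)^y G(x,y)`
(pull-back convention, `hasStaggeredEvenTorusLRO_iff`), holds iff
`0 < liminf_k |Λ|⁻¹ Σ_{x ∈ (ℤ/Lℤ)^d} (-1)^{Σ val xᵢ} G_L(0, x)` along `L = 2k + 2`, `|Λ| = L^d`.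
Proof: volume by volume (side `2(k+1) = 2k+2`) the two normalised sums agree — reindex the
fundamental domain along `Torus.proj` (`staggeredSum_torusPullback_succ`), then use that on an
even torus the Néel sign is a character and `G` is translation invariant
(`staggeredSum_div_eq_onePoint_div`); the index shift `k ↦ k + 1` does not change the `liminf`
(`Filter.liminf_nat_add`). This is Dyson–Lieb–Simon's passage from the bulk form (4),
`⟨(|Λ|⁻¹ Σ_α S_α)²⟩`, to (4′), `|Λ|⁻¹ g_p` with `g_p = ⟨Ŝ_p · Ŝ_{-p}⟩` a one-point sum by
translation invariance ((5), (8)), at the antiferromagnetic momentum `p = (π, …, π)` (p. 338; sign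
`(-1)^{|α|}`, §6 p. 365; even sides, Theorem 5.1); Kennedy–Lieb–Shastry (1988), eq. (3).
[cite: DysonLiebSimon1978, §1 eqs. (4), (4′), (8), pp. 337–338; §6 p. 365] -/
theorem hasStaggeredEvenTorusLRO_iff_onePoint_holds :
    hasStaggeredEvenTorusLRO_iff_onePoint (d := d) := by
  intro G hG
  have key : ∀ k : ℕ,
      (∑ x ∈ halfOpenBox d (2 * (k + 1)), ∑ y ∈ halfOpenBox d (2 * (k + 1)),
          latticeStagger x * latticeStagger y * torusPullback G (2 * (k + 1)) x y) /
        ((halfOpenBox d (2 * (k + 1))).card : ℝ) ^ 2 =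
      (∑ x : TorusSite d (2 * k + 2), (-1 : ℝ) ^ (∑ i, (x i).val) * G (2 * k + 2) 0 x) /
        ((2 * k + 2 : ℕ) : ℝ) ^ d := fun k =>
    (staggeredSum_torusPullback_succ G (2 * k + 1)).trans
      (staggeredSum_div_eq_onePoint_div (L := 2 * k + 2) ⟨k + 1, by ring⟩ (G (2 * k + 2))
        (hG (2 * k + 2)))
  have hlim :
      liminf (fun k : ℕ => (∑ x ∈ halfOpenBox d (2 * k), ∑ y ∈ halfOpenBox d (2 * k),
          latticeStagger x * latticeStagger y * torusPullback G (2 * k) x y) /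
        ((halfOpenBox d (2 * k)).card : ℝ) ^ 2) atTop =
      liminf (fun k : ℕ => (∑ x : TorusSite d (2 * k + 2),
          (-1 : ℝ) ^ (∑ i, (x i).val) * G (2 * k + 2) 0 x) / ((2 * k + 2 : ℕ) : ℝ) ^ d) atTop :=
    (Filter.liminf_nat_add _ 1).symm.trans
      (Filter.liminf_congr (Filter.Eventually.of_forall key))
  exact Iff.of_eq (congrArg (fun r : ℝ => 0 < r) hlim)

end Literature.MathematicalPhysics.QuantumLattice
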